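import Literature.AlgebraicGeometry.Motives.SeesawChartTrivialised
import Literature.AlgebraicGeometry.Motives.SeesawSubschemeReprIdeal
import HarnessLib

/-!
# The seesaw closed subscheme: the link «algebra-side representability ⇒ `IsReprIdeal`» and locality of `Triv`

[MumfordAV1970] §10 (p. 89) / [GortzWedhorn2023] Thm. 24.66, bookkeeping between the chart files (`SeesawChartSections`,
test objects = `Γ(W, U)`-algebras `B`) and the global half (`SeesawSubschemeReprIdeal`, test objects = affine schemes
`S → U ⊆ W`):
* `triv_iff_trivFromBase`: `Triv X 𝓕 U B ↔ TrivFromBase X 𝓕 (specTestHom U B)` (`Iff.rfl`);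
* **`isReprIdeal_of_forall_triv_iff`**: if `Triv X 𝓕 U B ↔ J·B = 0` for every `Γ(W, U)`-algebra `B`, then
  `IsReprIdeal X 𝓕 U J` — an affine test scheme `S` is `Spec Γ(S, ⊤)` over `W`;
* (M0) `Triv.of_isScalarTower` (base change) and (M0′) `Triv.of_away_cover` (Zariski locality on the test algebra,
  from the statement `N1cDelta` applied to the cover of `Spec B` by the `D(g)`).
(Cell `hodgecm-mathlib`, M13 node N1, file S6 of the split plan; HOME certificate `B-plan/m13-glue/N1-Assembly.v9.B-p01g12.lean`
164baf9abb46c288 PART III §11–§12, decls token-identical.)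

## References
* [MumfordAV1970] D. Mumford, *Abelian Varieties* (1970), §10 p. 89.
* [GortzWedhorn2023] U. Görtz, T. Wedhorn, *Algebraic Geometry II* (2023), Thm. 24.66 (p. 405; proof pp. 407–408).
-/

set_option autoImplicit false

noncomputable section

-- `TopCat.Presheaf`/`Scheme.Modules` are not reducible (as in Mathlib's `AlgebraicGeometry/Modules`).
set_option backward.isDefEq.respectTransparency false

universe u

open CategoryTheory CategoryTheory.Limits AlgebraicGeometry MonoidalCategory CartesianMonoidalCategory
  Opposite

namespace Literature.AlgebraicGeometry.Motives

namespace SeesawSubscheme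

open Literature.AlgebraicGeometry.Modules

variable (X : SchemeOver ℂ) {W : SchemeOver ℂ} (𝓕 : (X ⊗ W).left.Modules) (U : W.left.affineOpens)


/-! ## §1 The link -/

/-- `Triv X 𝓕 U B` is literally `TrivFromBase X 𝓕 (specTestHom U B)`. [cite: MumfordAV1970, §10 (p. 89)] -/
theorem triv_iff_trivFromBase (B : Type) [CommRing B] [Algebra Γ(W.left, U) B] :
    Triv X 𝓕 U B ↔ TrivFromBase X 𝓕 (specTestHom U B) :=
  Iff.rfl


/-- **§11 THE LINK** ([MumfordAV1970] §10 p. 89, bookkeeping): if for every `Γ(W, U)`-algebra `B` the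
pulled-back `𝓕_B` is trivialised from the base exactly when `J·B = 0`, then `J` represents on the chart
`U` in the sense of the global half (`IsReprIdeal`: affine test schemes `S → U ⊆ W`), because
such an `S` is `Spec Γ(S, ⊤)` over `W`. [cite: MumfordAV1970, §10 (p. 89)] -/
theorem isReprIdeal_of_forall_triv_iff (J : Ideal Γ(W.left, U))
    (h : ∀ (B : Type) [CommRing B] [Algebra Γ(W.left, U) B],
      Triv X 𝓕 U B ↔ J.map (algebraMap Γ(W.left, U) B) = ⊥) :
    IsReprIdeal X 𝓕 U J := by
  intro S _ u hu
  letI := testAlgebra U u hu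
  have halg : algebraMap Γ(W.left, U) Γ(S.left, (⊤ : S.left.Opens)) = (testRingHom U u hu).hom := rfl
  rw [ker_app_eq_ker_testRingHom U u hu, ← halg, ← Ideal.map_eq_bot_iff_le_ker, ← h]
  constructor
  · intro ht
    rw [triv_iff_trivFromBase, ← specTestToS_comp U u hu]
    exact ht.comp X 𝓕 _
  · intro ht
    rw [triv_iff_trivFromBase] at ht
    rw [← sToSpecTest_comp U u hu]
    exact ht.comp X 𝓕 _


/-! ## §12 (M0) base change and (M0′) Zariski locality of `Triv X 𝓕 U` — the two structural inputs
of the algebra gluing (mid-b) -/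

/-- **(M0) `Triv` is stable under base change**: if `𝓕_B` is trivialised from the base, so is `𝓕_C` for every
`B`-algebra `C`. [cite: MumfordAV1970, §10 (p. 89)] -/
theorem Triv.of_isScalarTower (B C : Type) [CommRing B] [Algebra Γ(W.left, U) B] [CommRing C]
    [Algebra Γ(W.left, U) C] [Algebra B C] [IsScalarTower Γ(W.left, U) B C] (hB : Triv X 𝓕 U B) :
    Triv X 𝓕 U C := by
  rw [triv_iff_trivFromBase] at hB ⊢
  rw [← specTestMap_comp U (IsScalarTower.toAlgHom Γ(W.left, U) B C)]
  exact hB.comp X 𝓕 _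

/-- **(M0′) `Triv` is Zariski-local on the test algebra**: if `Ideal.span s = ⊤` and `𝓕_{B_g}` is trivialised
from the base for every `g ∈ s`, then `𝓕_B` is (the statement `N1cDelta` applied
to the cover of `Spec B` by the `D(g)`, each identified with `Spec B_g` through `IsOpenImmersion.lift`).
[cite: MumfordAV1970, §10 (p. 89)] -/
theorem Triv.of_away_cover (hδ : N1cDelta) [IsProper X.hom] [GeometricallyIntegral X.hom] [𝓕.IsQuasicoherent]
    (h𝓕 : HasRank 𝓕 1) (B : Type) [CommRing B] [Algebra Γ(W.left, U) B] (s : Finset B)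
    (hs : Ideal.span (s : Set B) = ⊤) (h : ∀ g ∈ s, Triv X 𝓕 U (Localization.Away g)) :
    Triv X 𝓕 U B := by
  rw [triv_iff_trivFromBase]
  refine hδ X W 𝓕 h𝓕 (specTest U B) (specTestHom U B) fun p => ?_
  -- a member `g ∈ s` of the cover with `p ∈ D(g)`
  obtain ⟨g, hg, hgp⟩ : ∃ g ∈ s, g ∉ (p : PrimeSpectrum B).asIdeal := by
    by_contra hall
    have hle : Ideal.span (s : Set B) ≤ (p : PrimeSpectrum B).asIdeal :=
      Ideal.span_le.mpr fun g hg => by_contra fun hgp => hall ⟨g, hg, hgp⟩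
    rw [hs, top_le_iff] at hle
    exact (p : PrimeSpectrum B).2.ne_top hle
  refine ⟨awayOpen U g, (mem_awayOpen U g p).mpr hgp, ?_⟩
  -- the open piece `D(g)` is `Spec B_g` over `W`
  haveI := isOpenImmersion_awayTestMap U g
  let κl : (openTest (awayOpen U g)).left ⟶ (specTest U (Localization.Away g)).left :=
    IsOpenImmersion.lift (awayTestMap U g).left (awayOpen U g).ι (range_ι_awayOpen_subset U g)
  have hκl : κl ≫ (awayTestMap U g).left = (awayOpen U g).ι := IsOpenImmersion.lift_fac _ _ _
  let κ : openTest (awayOpen U g) ⟶ specTest U (Localization.Away g) :=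
    Over.homMk κl (by
      change κl ≫ specTestι U (Localization.Away g) ≫ W.hom = (awayOpen U g).ι ≫ (specTestι U B ≫ W.hom)
      rw [← hκl, ← awayTestMap_left_comp_specTestι U g]
      simp only [Category.assoc])
  have hκ : κ ≫ specTestHom U (Localization.Away g) = restrictTest (awayOpen U g) (specTestHom U B) := by
    ext : 1
    change κl ≫ specTestι U (Localization.Away g) = (awayOpen U g).ι ≫ specTestι U B
    rw [← hκl, ← awayTestMap_left_comp_specTestι U g]
    simp only [Category.assoc]
  have hg' : TrivFromBase X 𝓕 (specTestHom U (Localization.Away g)) :=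
    (triv_iff_trivFromBase X 𝓕 U (Localization.Away g)).mp (h g hg)
  have ht := TrivFromBase.comp X 𝓕 κ hg'
  rw [hκ] at ht
  exact ht

end SeesawSubscheme

end Literature.AlgebraicGeometry.Motives

end
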